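import Literature.MathematicalPhysics.QuantumFieldTheory.Balaban1983to89.B8Thm4TorusAt
import Literature.MathematicalPhysics.QuantumFieldTheory.Balaban1983to89.B8Eq133Hypotheses
import Literature.MathematicalPhysics.QuantumFieldTheory.Balaban1983to89.B8Eq138LandauZd
import Literature.MathematicalPhysics.QuantumFieldTheory.Balaban1983to89.B9Eq340HolderZd
import Literature.MathematicalPhysics.QuantumFieldTheory.Balaban1983to89.B7Prop4GeneralLevels
import Literature.MathematicalPhysics.QuantumFieldTheory.Balaban1983to89.B8Eq146AExpansion

/-!
# `Balaban1983to89.B8Thm2TorusAt` — T. Bałaban, *Spaces of regular gauge field configurations on a lattice and gauge fixing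
# conditions*, Commun. Math. Phys. **99** (1985) 75–102 [Balaban1985RegularSpaces] ("B8"), **Theorem 2** (p. 83) FOR THE DOMAIN
# SEQUENCE `Ω_j = T_η`, `j = 0, …, k` (p. 77, the admitted case «Ω_j = T_η for j = 0,1,…,l, l ≤ k» with `l = k`), TYPED AS A
# HYPOTHESIS SCHEMA WITH ITS HYPOTHESIS (1.35) AND ITS CONCLUSION (1.36)–(1.39) CONCRETE — the Theorem-2 companion of the
# Theorem-4 interface `B8Thm4TorusAt.Thm4TorusAt` (same carriers, same periodic-`ℤᵈ` reading of the torus `T_η`, same letters),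
# and the modus ponens AT A PAIR WITH EQUAL `k`-TH AVERAGES (`concl_of_thm2TorusAt_pair`)

statement-level skeleton of published theorems with citation tags; proofs where landed; nothing here is a claim about the Yang–Mills mass gap

PDF held: `paper:balaban1985-cmp99-regular-spaces-gauge-fixing` (journal page = PDF page + 74); p. 82 [PDF 8] read on the x2 page render
`run/shared/lean/pub/pub-balaban/b2b-balaban-ref1/pages/1985-cmp99-regular-spaces-gauge-fixing/…-p008-x2.png` (displays (1.33)–(1.38)),
pp. 77, 79, 81, 83 [PDF 3, 5, 7, 9] on the text layer.

WHY (mega-formalisation `lit-balaban`, director-ym R141 (B) typer seat `lit-balaban-type-B8` gen 2; consumer of record: the ym3 cell's item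
stmt-QuantumFields-19200 leaf **V3-A «GAUGE CHART»** — *«[B8] Thm 2 (1.33)–(1.39): for U₀ … and every U … ∃ u … u•U = exp(A)·U₀
bondwise … ‖A‖_∞ ≤ B₁(ε₀ + L³ε₁)L^{−k}, ‖∇_{U₀}A‖_∞ ≤ B₁(…)L^{−2k}, Landau condition R(U₀)D^*_{U₀}A = 0, and u unique»*
(`pub/ym-fleet/ym-ust-19200-p1/CARD-19200-V3-split.md` §2; GO on the ym-fleet bus 2026-08-26T17:44Z); pub-ymgap DAG nodes N05 ([B8]) and
N16 (NE3) read the same sentence in the all-torus geometry).  The tree types Theorem 2 ABSTRACTLY (`B8.Thm2Printed` over `B8.GFData`),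
at `ℤᵈ` objects for GENERAL `{Ω_j}` (`B8LeafModelZd3.zdGF3`, `B8Thm2GaugeFixedKLevel`), and Theorem 4 for `Ω_j = T_η` as the interface
`B8Thm4TorusAt.Thm4TorusAt L k P η c₁ G Reg Restr Concl` with `Reg ∕ Restr ∕ Concl` ABSTRACT (its hypothesis is (1.66), Theorem 4's).
THEOREM 2's own hypothesis (1.35) «|(U′U₀)‾ʲ − Ū₀ʲ| < α₁ on Λ_j» and its own conclusion — ALL THREE members of (1.36) incl. the Hölder
member, (1.37), (1.38), BOTH members of (1.39) — had no typed form for the torus geometry: this file supplies it, token for token parallel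
to `Thm4TorusAt`, with the member readings OF RECORD of the N05 family `B8LeafModelZd3.zdGF3` specialised to `Ω_j := univ`, `Λ_j :=
torusLam k j` (`∅` below `k`, `T^{(k)}` at `k`).

THE PRINTED TEXT (verbatim).  p. 83 [PDF 9]: «Theorem 2. There exist constants B₁, B₂(β₀), c₁ such that for arbitrary U₀, U′U₀ satisfying
(1.33)–(1.35) with α₀ + α₁ ≦ c₁ there exists exactly one gauge transformation u satisfying (1.29) and such that the conditions (1.36)–(1.39)
hold for the configuration U₁ = U′^{u⁻¹}.»  p. 82 [PDF 8]: «U₀ ∈ 𝔄_k({Ω_j}, α₀), U₀ satisfies the regularity condition (3.35) in [4]. (1.33)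
U′U₀ ∈ 𝔄_k({Ω_j}, α₀) ∩ Ax_k(𝔅_k, U₀), (1.34)  |(U′U₀)‾ʲ − Ū₀ʲ| < α₁ on Λ_j, j = 0, 1, …, k. (1.35) … U₁ = e^{iηA}, |A| < B₁(α₀ + α₁)(Lʲη)⁻¹,
|∇^η_{U₀}A| < B₁(α₀ + α₁)(Lʲη)⁻², ‖A‖_{1,β} < B₂(β₀)(α₀ + α₁)(Lʲη)^{−2−β}, β ≦ β₀ < 1, on Ω_j, j = 0, 1, …, k, (1.36)  Q_j(U₀, ηA) = B on
Λ_j, j = 0, 1, …, k, B is given by formula (1.31) with V′ = Ũ′ʲ, |B| < 2dLα₁ by the assumption (1.35), (1.37)  R(U₀)D^{η*}_{U₀}A = 0.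
(1.38)»  p. 83: «|D^{η*}_{U₀}D^η_{U₀}A|, |Δ^η_{U₀}A| < B₁(α₀ + α₁)(Lʲη)⁻³ on Ω_j, j = 0, 1, …, k. (1.39) Of course we want to prove that the
constants B₁, B₂(β₀) in (1.36), (1.39) are absolute constants depending on d and L only, B₂(β₀) on β₀ also.»  (1.29) p. 81: «(R̄₀uʲ)(y) = 1
for y ∈ Λ_j, j = 0, 1, …, k».  p. 77: «Let us notice that we admit the case where some domains Ω_j are equal to T_η, for example Ω_j = T_η
for j = 0,1,…,l, l ≤ k.»; (1.5)–(1.6): «Λ_j = Ω_j^{(j)} ∖ Ω_{j+1}^{(j)} … Ω₀ = ⋃_j Bʲ(Λ_j)» — so for `Ω_j = T_η`, `j ≤ k`: `Λ_j = ∅`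
(`j < k`), `Λ_k = T^{(k)}`, `𝔅_k = T^{(k)}` (`B8Thm4TorusAt.torusLam`).

WHAT THIS FILE TYPES ∕ PROVES (kernel; std axioms; the `def`s are hypothesis SHAPES with bodies, asserted for nothing):
* §1 **`Cond135T L k U₀ U′ α₁`** — (1.35) FOR `Ω_j = T_η`: the (1.35) of record `B8Eq133Hypotheses.Hyp135 L k Λ α₁ U₀ U′` (r05; p. 77 bond
  convention `B8Eq113ClassBk.bondsOn`) at `Λ = torusLam k` keeps only level `k`, at EVERY level-`k` bond: `hyp135_torusLam_iff`;
  `cond135T_of_avgIter_eq` ∕ `hyp135_torusLam_of_avgIter_eq` (equal `k`-th averages ⇒ (1.35) for every `α₁ > 0`), `cond135T_one_left`.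
* §2 the CONCLUSION for `U₁ = U′^{u⁻¹} = e^{iηA}` in the letters of record of `B8LeafModelZd3.zdGF3` at `Ω_j = univ`: **`C136T`** = (1.36), all
  three members, the third for every Hölder index `0 ≤ β ≤ β₀` (`B9Eq340HolderZd.hquot` of the forward covariant derivatives
  `B8Ineq132.covDerivFwd η U₀ μ A_κ` over the admissible pairs `AdmPair η len` of [4] (3.40)); **`C137T`** = (1.37) «|B| < 2dLα₁» read, as in
  `zdGF3.C137`, on `Q_k(U₀, ηA)` = `B7Prop4GeneralLevels.logCovIter L U₀ (iEta η A) k` at every level-`k` bond (`Λ_j = ∅` below `k`);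
  (1.38) = `B8Eq138LandauZd.IsLandau138 L k η univ (torusLam k) U₀ A` (multiplier form of record, `m = k` levels, Dirichlet domain `Ω₀ = T_η`);
  **`C139T`** = (1.39), both members (`B8Eq143PlaqExpansion.pdiv ∘ B8Eq146AExpansion.plaqCovDeriv` = `D^{η*}_{U₀}D^η_{U₀}A`, and the
  componentwise `B8Eq138LandauZd.covLap` = `Δ^η_{U₀}A`, zdGF3's declared reading (iv)); **`Concl2T L k P η β₀ B₁ B₂ len α₀ α₁ U₀ U′ u`** =
  «∃ A, A self-adjoint and P-periodic, `mgauge U₀ u⁻¹ U′ = cfgExp η A` (U₁ = U′^{u⁻¹} = e^{iηA}, moving-frame action (1.17) =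
  `B7Eq92Concrete.mgauge`, exponential chart `B8Eq184Proof.cfgExp`) ∧ C136T ∧ C137T ∧ (1.38) ∧ C139T».
* §3 **`Thm2TorusAt L k P η β₀ B₁ B₂ c₁ len G Reg`** — THE INTERFACE: for `α₀, α₁ > 0`, `α₀ + α₁ ≤ c₁`, `P`-periodic `G`-valued `U₀`, `U′`:
  (1.33) = `InAk L k η α₀ (fun _ ↦ univ) U₀` ∧ `Reg U₀` [«(3.35) of [4]», ABSTRACT as in `Thm4TorusAt`]; (1.34) = `InAk … (U′ * U₀)` ∧
  `InAx L k (torusLam k) U₀ (U′ * U₀)`; (1.35) = `Hyp135 L k (torusLam k) α₁ U₀ U′`; CONCLUSION: exactly one `P`-periodic `G`-valued `u` with (1.29) =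
  `Restr129 L k (torusLam k) U₀ u` and `Concl2T … α₀ α₁ U₀ U′ u`; **`Thm2TorusUniform`** displays print's quantifier ORDER (the constants
  `B₁, B₂(β₀), c₁` BEFORE the data `k, P, η`); `thm2TorusAt_of_uniform`; `Thm2TorusAt.exists_sup` (the existence half unpacked down to the
  (1.36)₁ sup member, the one the consumers read first).
* §4 NON-VACUITY OF THE HYPOTHESIS CLASS: `hypotheses_of_one_right` (for ANY `U₀ ∈ 𝔄_k({Ω_j}, α₀)` and any `Λ` the perturbation `U′ = 1`
  satisfies (1.34)–(1.35): `inAx_self`, `hyp135_one_left`), `hypotheses_one_one` (the trivial pair, `B8Prop6OfThm4.one_inAk`; cf. r05's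
  `B8Eq133Hypotheses.hyp133to135_one` with the concrete (3.35)).
* §5 **`concl_of_thm2TorusAt_pair`** — THEOREM 2 (TORUS GEOMETRY) APPLIES AT A PAIR WITH EQUAL `k`-TH AVERAGES (the consumer's V3-A shape;
  torus twin of `B8Thm4TorusAt.concl_of_thm4TorusAt_pair` with (1.35) in place of (1.66)): for an `AvgClosed` gauge group `G`, `L ≥ 2`,
  `G`-valued `N·Lᵏ`-periodic `U₀`, `U` with (1.7) at `α` (Prop.-1∕2-small) and `Ūᵏ = Ū₀ᵏ`, the axial representative `U^{u₀}`, `u₀ =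
  B8Eq166ConstraintPair.ptw L U₀ U k`, satisfies (1.34) (`inAx_pertPair`) and (1.35) EXACTLY (**`cond135T_pertPair`**: «the top average is
  kept», `pinnedTwistedFix_global`), so `Thm2TorusAt` yields exactly one periodic `G`-valued `u` with (1.29) and (1.36)–(1.39) for
  `U′ = U^{u₀}U₀⁻¹`, from `U₀, U ∈ 𝔄_k(univ, α)` and `Reg U₀` ALONE.
* §6 (POINTERS ONLY, no objects) THE SETUP-TORUS DICTIONARY: a configuration ∕ gauge transformation of the LQB lane's `Setup` torus
  `Site P 0` is read here through the periodic pullback `B10Eq27TorusAxialLog.pull` (base point `0`; `U(N)` through `unitsField`, `SU(N)`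
  through `toUField`), which is `sitesPerDir`-periodic; print's averaging on that torus is `B10Eq69TorusPullback.avgT`, (1.7)+(1.9) is
  `B10Eq68TorusRegularity.InSpace`.  The `Setup`-object twin of `Thm2TorusAt` (uniqueness among `GaugeTransf P 0 G`, the periodic-gauge
  descent) is a separate module of this seat; this file imports nothing of `Setup`.

HONEST SCOPE ∕ DECLARED READINGS.  (i) An INTERFACE (hypothesis shape) and bookkeeping theorems: Theorem 2 is NOT proved here or anywhere in
the tree at a curved background; nothing is inferred from the paper beyond the quoted sentences.  (ii) Readings = those declared by
`B8LeafModelZd3` (module docstring (i)–(v)) at `Ω_j = univ`: `∇^η_{U₀}A` = the forward covariant derivatives of the components; the Hölder norm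
‖·‖_{1,β} = the (3.40)-quotients of those, length function `len` a parameter; (1.37) = the bound `|Q_k(U₀, ηA)| < 2dLα₁` (print's identity
«Q_j(U₀, ηA) = B, B given by (1.31) with V′ = Ũ′ʲ» is algebraic from (1.29)–(1.31), p. 83 «basically of an algebraic character and it follows
from the construction», and is NOT displayed); (1.38) in multiplier form; (1.39)₂ componentwise; «on Ω_j, j = 0, …, k» with every `Ω_j = T_η`
is stated at EVERY `j ≤ k` verbatim (the `j = k` clause is the binding one); strict `<` as printed; `U₁ = e^{iηA}` as «∃ A self-adjoint with
U′^{u⁻¹} = e^{iηA} bondwise» (no logarithm chosen).  (iii) «(3.35) of [4]» stays the abstract `Reg` exactly as in `Thm4TorusAt` (the N16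
consumers instantiate `B8Eq133Hypotheses.Reg335Zd`; print drops it via Prop. 6, p. 82 «eventually we will drop it out of the assumptions»).
(iv) The periodic-`ℤᵈ` reading of `T_η` is the lineage's (`B8Thm4TorusAt`, `B8Eq166ConstraintPair.ptw_periodic`); `G` = the gauge group as
a subgroup of `𝔸ˣ` (`unitaryUnits 𝔸` for `U(N)`).  (v) HAZARDS ALREADY CERTIFIED, for the reader: `B8LeafModelZd3Boundary` ∕
`B8LeafModelZdBoundary` refute `B8.Thm2Printed` on members whose `Ω₀ ⊊ ℤᵈ` has a boundary layer — NOT this all-torus geometry; the Theorem-8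
sibling's `∇`∕Hölder clauses fail `k`-uniformly for `|f|₍₋₂₎`-sources (GAPS G-B8-13) — this schema is Theorem 2 (source `f = 0`), not
Theorem 8.  Count-neutral; nothing continuum ∕ ℝ⁴ ∕ OS ∕ mass-gap ∕ Clay.
-/

noncomputable section

open scoped BigOperators

namespace Literature.MathematicalPhysics.QuantumFieldTheory.Balaban1983to89.B8Thm2TorusAt

open B7Prop1Explicit B7Prop2Explicit B8Ineq132 B8Eq119TwistedAxial
open B8Eq166ConstraintPair B8Thm4HypothesesPair
open B8Thm4TorusAt (torusLam mem_torusLam_iff torusLam_self torusLam_of_ne Thm4TorusAt pertPair_periodic)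
open B8Lemma1NonAbelian (mulCfg pert pert_mulCfg)
open B12Ineq417Flat (shiftCfg)
open B7Eq92Concrete (mgauge)
open B8Eq184Proof (cfgExp)
open B8Eq146AExpansion (iEta plaqCovDeriv)
open B8Eq143PlaqExpansion (pdiv)
open B7Prop4GeneralLevels (logCovIter)
open B8Eq138LandauZd (IsLandau138 covLap)
open B9Eq340HolderZd (hquot AdmPair)
open B8Eq133Hypotheses (Hyp135 Reg335Zd)
open B8Eq113ClassBk (bondsOn mem_bondsOn)

-- `Site` alone resolves to the torus sites of `Setup.lean` in this namespace; the `ℤ^d` sites of `B7Prop1Explicit` are `LSite` here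
-- (the LQB torus files' convention, `B10Eq68TorusRegularity`).
open B7Prop1Explicit renaming Site → LSite

variable {d : ℕ}

/-! ## §1 The hypothesis (1.35) «|(U′U₀)‾ʲ − Ū₀ʲ| < α₁ on Λ_j, j = 0, 1, …, k» -/

section Hypothesis135

variable {𝔸 : Type*} [NormedRing 𝔸] [NormedAlgebra ℂ 𝔸] [CompleteSpace 𝔸]

/-- **(1.35) FOR `Ω_j = T_η`, `j = 0, …, k`**: with `Λ_j = ∅` for `j < k` and `Λ_k = T^{(k)}` (`torusLam`) the condition reads
«|(U′U₀)‾ᵏ − Ū₀ᵏ| < α₁» at EVERY level-`k` bond — the iterated [3] averages (43) `B7Prop2Explicit.avgIter` of the full field `U′U₀` and of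
the background; the torus reading of the (1.35) of record `B8Eq133Hypotheses.Hyp135 L k (torusLam k)` (`hyp135_torusLam_iff`), the hypothesis
of Theorem 2 where Theorem 4 has (1.66) (`B8Thm4TorusAt.Cond166T`). [cite: Balaban1985RegularSpaces, (1.35) p.82, (1.5) p.77, p.77 («Ω_j = T_η for j = 0,1,…,l, l ≤ k»)] -/
def Cond135T (L k : ℕ) (U₀ U' : LSite d → Fin d → 𝔸ˣ) (α₁ : ℝ) : Prop :=
  ∀ (x : LSite d) (ν : Fin d), ‖((avgIter L (U' * U₀) k x ν : 𝔸ˣ) : 𝔸) - (avgIter L U₀ k x ν : 𝔸)‖ < α₁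

/-- **(1.35) OF RECORD (`B8Eq133Hypotheses.Hyp135`, r05: «|(U′U₀)‾ʲ − Ū₀ʲ| < α₁ on Λ_j», p. 77 bond convention
`B8Eq113ClassBk.bondsOn`) FOR THE CONSTRAINT SEQUENCE `torusLam k` IS `Cond135T`**: below `k` there is no constraint bond, at `k` every
level-`k` bond is one. [cite: Balaban1985RegularSpaces, (1.35) p.82, (1.5) p.77, p.77 (bond convention before (1.5))] -/
theorem hyp135_torusLam_iff (L k : ℕ) (U₀ U' : LSite d → Fin d → 𝔸ˣ) (α₁ : ℝ) :
    Hyp135 L k (torusLam k) α₁ U₀ U' ↔ Cond135T L k U₀ U' α₁ := by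
  constructor
  · intro h x ν
    exact h k le_rfl x ν ((mem_bondsOn _ _ _ _).2 (Or.inl (by rw [torusLam_self]; exact Set.mem_univ _)))
  · intro h j hj x ν hb
    by_cases hjk : j = k
    · subst hjk; exact h x ν
    · exfalso
      rw [mem_bondsOn, torusLam_of_ne hjk] at hb
      rcases hb with hb | hb <;> exact hb

/-- **Equal `k`-th averages give (1.35) on the torus for every `α₁ > 0`** (the difference vanishes). [cite: Balaban1985RegularSpaces, (1.35) p.82, (1.28) p.81] -/
theorem cond135T_of_avgIter_eq {L k : ℕ} {U₀ U' : LSite d → Fin d → 𝔸ˣ} (h : avgIter L (U' * U₀) k = avgIter L U₀ k) {α₁ : ℝ}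
    (hα₁ : 0 < α₁) : Cond135T L k U₀ U' α₁ := by
  intro x ν
  rw [h, sub_self, norm_zero]
  exact hα₁

/-- The trivial perturbation `U′ = 1` satisfies (1.35) over any background, for every `α₁ > 0` (p. 78: the gauge conditions are
«relative to some fixed configuration U₀ … the surfaces pass through the element U₀»). [cite: Balaban1985RegularSpaces, (1.35) p.82, (1.16) p.78] -/
theorem cond135T_one_left (L k : ℕ) (U₀ : LSite d → Fin d → 𝔸ˣ) {α₁ : ℝ} (hα₁ : 0 < α₁) :
    Cond135T L k U₀ (1 : LSite d → Fin d → 𝔸ˣ) α₁ :=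
  cond135T_of_avgIter_eq (by rw [one_mul]) hα₁

/-- Equal `k`-th averages give the (1.35) of record on `torusLam k`, for every `α₁ > 0`. [cite: Balaban1985RegularSpaces, (1.35) p.82, (1.28) p.81] -/
theorem hyp135_torusLam_of_avgIter_eq {L k : ℕ} {U₀ U' : LSite d → Fin d → 𝔸ˣ} (h : avgIter L (U' * U₀) k = avgIter L U₀ k) {α₁ : ℝ}
    (hα₁ : 0 < α₁) : Hyp135 L k (torusLam k) α₁ U₀ U' :=
  (hyp135_torusLam_iff L k U₀ U' α₁).2 (cond135T_of_avgIter_eq h hα₁)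

end Hypothesis135

/-! ## §2 The conclusion (1.36)–(1.39) for `Ω_j = T_η`, in the letters of record of `B8LeafModelZd3.zdGF3` -/

section Members

variable {𝔸 : Type*} [NormedRing 𝔸] [StarRing 𝔸] [NormedAlgebra ℂ 𝔸] [CompleteSpace 𝔸]

omit [StarRing 𝔸] in
/-- **(1.36) FOR `Ω_j = T_η`** — «|A| < B₁(α₀ + α₁)(Lʲη)⁻¹, |∇^η_{U₀}A| < B₁(α₀ + α₁)(Lʲη)⁻², ‖A‖_{1,β} < B₂(β₀)(α₀ + α₁)(Lʲη)^{−2−β},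
β ≦ β₀ < 1, on Ω_j, j = 0, 1, …, k» with every `Ω_j = T_η`, smallness `s = α₀ + α₁`: at EVERY bond ∕ site ∕ admissible pair and every
`j ≤ k` (the `j = k` clause binds), (1) the sup member, (2) the gradient member on the forward covariant derivatives `D^η_{U₀,μ}A_κ`
(`B8Ineq132.covDerivFwd`, (1.1) p. 76), (3) the Hölder member for every `0 ≤ β ≤ β₀`: the (3.40)-quotients of [4] of `D^η_{U₀,μ}A_κ`
(`B9Eq340HolderZd.hquot η β len U₀`, admissible pairs `AdmPair η len`: `0 < |x′ − x|`, `η|x′ − x| ≤ 1` for the length function `len`).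
Readings (ii) of the module docstring (= `B8LeafModelZd3.zdGF3.C136` at `Ω_j = univ`, pointwise and strict as printed). [cite: Balaban1985RegularSpaces, (1.36) p.82; Balaban1985BackgroundPropagators, (3.40) p.397] -/
def C136T (L k : ℕ) (η β₀ B₁ B₂ : ℝ) (len : LSite d → ℝ) (s : ℝ) (U₀ : LSite d → Fin d → 𝔸ˣ) (A : LSite d → Fin d → 𝔸) : Prop :=
  (∀ j, j ≤ k → ∀ (x : LSite d) (μ : Fin d), ‖A x μ‖ < B₁ * s * ((L : ℝ) ^ j * η)⁻¹) ∧
  (∀ j, j ≤ k → ∀ (x : LSite d) (μ κ : Fin d),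
      ‖covDerivFwd η U₀ μ (fun z => A z κ) x‖ < B₁ * s * (((L : ℝ) ^ j * η)⁻¹) ^ 2) ∧
  (∀ β : ℝ, 0 ≤ β → β ≤ β₀ → ∀ j, j ≤ k → ∀ (μ κ : Fin d) (q : LSite d × LSite d), q ∈ AdmPair η len →
      hquot η β len U₀ (covDerivFwd η U₀ μ (fun z => A z κ)) q < B₂ * s * (((L : ℝ) ^ j * η)⁻¹) ^ (2 + β))

omit [StarRing 𝔸] in
/-- **(1.37) FOR `Ω_j = T_η`** — «Q_j(U₀, ηA) = B on Λ_j, j = 0, 1, …, k, B is given by formula (1.31) with V′ = Ũ′ʲ, |B| < 2dLα₁»: with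
`Λ_j = ∅` below `k` and `Λ_k = T^{(k)}`, the bound at EVERY level-`k` bond for `Q_k(U₀, ηA)` = the composite (127) of [3] of the
covariant one-step maps, `B7Prop4GeneralLevels.logCovIter L U₀ (iEta η A) k` (`iEta η A = iηA`, `B8Eq146AExpansion.iEta`) — the
reading of `B8LeafModelZd3.zdGF3.C137` (the identity «= B» is algebraic from (1.29)–(1.31) and not displayed, docstring (ii)).
[cite: Balaban1985RegularSpaces, (1.37) p.82, (1.31) p.82; Balaban1985Averaging, (127) p.37] -/
def C137T (L k : ℕ) (η α₁ : ℝ) (U₀ : LSite d → Fin d → 𝔸ˣ) (A : LSite d → Fin d → 𝔸) : Prop :=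
  ∀ (x : LSite d) (ν : Fin d), ‖logCovIter L U₀ (iEta η A) k x ν‖ < 2 * (d : ℝ) * L * α₁

omit [StarRing 𝔸] in
/-- **(1.39) FOR `Ω_j = T_η`** — «|D^{η*}_{U₀}D^η_{U₀}A|, |Δ^η_{U₀}A| < B₁(α₀ + α₁)(Lʲη)⁻³ on Ω_j, j = 0, 1, …, k»: at every bond and every
`j ≤ k`, (1) the covariant divergence (1.2) of the covariant exterior derivative of `A` (`B8Eq143PlaqExpansion.pdiv η U₀` of
`B8Eq146AExpansion.plaqCovDeriv η U₀ A`, [4] (3.4)), (2) the componentwise covariant Laplacian `Σ_μ D^{η*}_{U₀,μ}D^η_{U₀,μ}A_κ`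
(`B8Eq138LandauZd.covLap`, [4] (3.23)) — both members carried, reading (iv) of `B8LeafModelZd3` (= `zdGF3.C139` at `Ω_j = univ`,
pointwise, strict). [cite: Balaban1985RegularSpaces, (1.39) p.83; Balaban1985BackgroundPropagators, (3.4) p.390, (3.23) p.394] -/
def C139T (L k : ℕ) (η B₁ s : ℝ) (U₀ : LSite d → Fin d → 𝔸ˣ) (A : LSite d → Fin d → 𝔸) : Prop :=
  (∀ j, j ≤ k → ∀ (x : LSite d) (μ : Fin d),
      ‖pdiv η U₀ (plaqCovDeriv η U₀ A) μ x‖ < B₁ * s * (((L : ℝ) ^ j * η)⁻¹) ^ 3) ∧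
  (∀ j, j ≤ k → ∀ (x : LSite d) (κ : Fin d),
      ‖covLap η U₀ (fun z => A z κ) x‖ < B₁ * s * (((L : ℝ) ^ j * η)⁻¹) ^ 3)

/-- **THE CONCLUSION OF THEOREM 2 FOR `U₁ = U′^{u⁻¹}`, `Ω_j = T_η`** (torus of `P` fine bonds per direction, read `P`-periodically on
`ℤᵈ`): there is a Lie-algebra-valued (bondwise SELF-ADJOINT) `P`-periodic `A` with «U₁ = U′^{u⁻¹} = e^{iηA}» — `mgauge U₀ u⁻¹ U′ =
cfgExp η A`, the moving-frame action (1.17) of `u⁻¹` relative to `U₀` (`B7Eq92Concrete.mgauge`, [3] (55); p. 80 «From now on we will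
use inverse elements u⁻¹») and the exponential chart `e^{iηA}` (`B8Eq184Proof.cfgExp`) — satisfying (1.36) `C136T` with `s = α₀ + α₁`,
(1.37) `C137T`, (1.38) «R(U₀)D^{η*}_{U₀}A = 0» in the multiplier form of record `B8Eq138LandauZd.IsLandau138 L k η univ (torusLam k) U₀ A`
(`k` averaging levels, `𝔅_k` from `torusLam k`, Dirichlet domain `Ω₀ = T_η`), and (1.39) `C139T`. [cite: Balaban1985RegularSpaces, Thm 2 p.83, (1.36)–(1.38) p.82, (1.39) p.83, (1.17) p.78] -/
def Concl2T (L k : ℕ) (P : ℤ) (η β₀ B₁ B₂ : ℝ) (len : LSite d → ℝ) (α₀ α₁ : ℝ) (U₀ U' : LSite d → Fin d → 𝔸ˣ)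
    (u : LSite d → 𝔸ˣ) : Prop :=
  ∃ A : LSite d → Fin d → 𝔸,
    (∀ (x : LSite d) (μ : Fin d), IsSelfAdjoint (A x μ)) ∧
    (∀ (x : LSite d) (i : Fin d) (μ : Fin d), A (x + P • e i) μ = A x μ) ∧
    mgauge U₀ u⁻¹ U' = cfgExp η A ∧
    C136T L k η β₀ B₁ B₂ len (α₀ + α₁) U₀ A ∧ C137T L k η α₁ U₀ A ∧
    IsLandau138 L k η (Set.univ : Set (LSite d)) (torusLam k) U₀ A ∧ C139T L k η B₁ (α₀ + α₁) U₀ A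

/-! ## §3 THE INTERFACE: Theorem 2 for the domain sequence `Ω_j = T_η` -/

/-- **INTERFACE (HYPOTHESIS SHAPE) — Theorem 2, p. 83, FOR THE DOMAIN SEQUENCE `Ω_j = T_η`, `j = 0, …, k`** (p. 77, admitted case), the
torus `T_η` read as `P`-periodic data on `ℤᵈ` (`P = N·Lᵏ` fine bonds per direction in the consumers), with Theorem 2's constants
`B₁, B₂(β₀), c₁` as parameters.  For `α₀, α₁ > 0` with `α₀ + α₁ ≤ c₁` and `P`-periodic `G`-valued `U₀`, `U′`: (1.33) = `U₀ ∈ 𝔄_k({T_η}, α₀)`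
[`B8Ineq132.InAk` with every `Ω_j = univ`] ∧ «U₀ satisfies the regularity condition (3.35) in [4]» [`Reg U₀`, ABSTRACT exactly as in
`B8Thm4TorusAt.Thm4TorusAt`]; (1.34) = `U′U₀ ∈ 𝔄_k({T_η}, α₀) ∩ Ax_k(𝔅_k, U₀)`, `𝔅_k` from `Λ_j = torusLam k j`
[`B8Eq119TwistedAxial.InAx L k (torusLam k)`]; (1.35) = `B8Eq133Hypotheses.Hyp135 L k (torusLam k) α₁ U₀ U′` (= `Cond135T`,
`hyp135_torusLam_iff`); CONCLUSION: exactly one `P`-PERIODIC `G`-valued gauge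
transformation `u` with (1.29) «(R̄₀uʲ)(y) = 1 for y ∈ Λ_j» [`B8Eq119TwistedAxial.Restr129 L k (torusLam k) U₀ u`] such that (1.36)–(1.39)
hold for `U₁ = U′^{u⁻¹}` [`Concl2T`].  Token for token the Theorem-2 companion of `Thm4TorusAt` ((1.35) for (1.66); concrete `Restr` and
`Concl`); asserted for nothing. [cite: Balaban1985RegularSpaces, Thm 2 p.83, (1.33)–(1.38) p.82, (1.39) p.83, (1.29) p.81, p.77 («Ω_j = T_η for j = 0,1,…,l, l ≤ k»)] -/
def Thm2TorusAt (L k : ℕ) (P : ℤ) (η β₀ B₁ B₂ c₁ : ℝ) (len : LSite d → ℝ) (G : Subgroup 𝔸ˣ)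
    (Reg : (LSite d → Fin d → 𝔸ˣ) → Prop) : Prop :=
  ∀ ⦃α₀ α₁ : ℝ⦄, 0 < α₀ → 0 < α₁ → α₀ + α₁ ≤ c₁ →
    ∀ U₀ U' : LSite d → Fin d → 𝔸ˣ, (∀ x κ, U₀ x κ ∈ G) → (∀ x κ, U' x κ ∈ G) →
      (∀ i : Fin d, shiftCfg (P • e i) U₀ = U₀) → (∀ i : Fin d, shiftCfg (P • e i) U' = U') →
      InAk L k η α₀ (fun _ => Set.univ) U₀ → Reg U₀ →
      InAk L k η α₀ (fun _ => Set.univ) (U' * U₀) → InAx L k (torusLam k) U₀ (U' * U₀) →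
      Hyp135 L k (torusLam k) α₁ U₀ U' →
      ∃ u : LSite d → 𝔸ˣ,
        ((∀ x, u x ∈ G) ∧ (∀ (x : LSite d) (i : Fin d), u (x + P • e i) = u x) ∧ Restr129 L k (torusLam k) U₀ u ∧
          Concl2T L k P η β₀ B₁ B₂ len α₀ α₁ U₀ U' u) ∧
        ∀ u' : LSite d → 𝔸ˣ, (∀ x, u' x ∈ G) → (∀ (x : LSite d) (i : Fin d), u' (x + P • e i) = u' x) →
          Restr129 L k (torusLam k) U₀ u' → Concl2T L k P η β₀ B₁ B₂ len α₀ α₁ U₀ U' u' → u' = u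

/-- **PRINT'S QUANTIFIER ORDER, displayed** — «There exist constants B₁, B₂(β₀), c₁ such that for arbitrary U₀, U′U₀ …» with p. 83 «the
constants B₁, B₂(β₀) in (1.36), (1.39) are absolute constants depending on d and L only, B₂(β₀) on β₀ also»: ONE triple `(B₁, B₂, c₁)`
(given `d`, `L`, the gauge group, `β₀` — and the lineage's length function `len`) serves EVERY number of levels `k ≥ 1`, every period `P`
and every spacing `η > 0`; the regularity clause «(3.35) of [4]» may depend on the member (`Reg k P η`).  Asserted for nothing.
[cite: Balaban1985RegularSpaces, Thm 2 p.83, p.83 (sentence after (1.39))] -/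
def Thm2TorusUniform (L : ℕ) (β₀ : ℝ) (len : LSite d → ℝ) (G : Subgroup 𝔸ˣ)
    (Reg : ℕ → ℤ → ℝ → (LSite d → Fin d → 𝔸ˣ) → Prop) : Prop :=
  ∃ B₁ B₂ c₁ : ℝ, 0 < B₁ ∧ 0 < B₂ ∧ 0 < c₁ ∧
    ∀ (k : ℕ) (P : ℤ) (η : ℝ), 1 ≤ k → 0 < η → Thm2TorusAt L k P η β₀ B₁ B₂ c₁ len G (Reg k P η)

/-- The uniform form hands each member its instance of the interface. [cite: Balaban1985RegularSpaces, Thm 2 p.83] -/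
theorem thm2TorusAt_of_uniform {L : ℕ} {β₀ : ℝ} {len : LSite d → ℝ} {G : Subgroup 𝔸ˣ}
    {Reg : ℕ → ℤ → ℝ → (LSite d → Fin d → 𝔸ˣ) → Prop} (h : Thm2TorusUniform L β₀ len G Reg) {k : ℕ} (hk : 1 ≤ k) (P : ℤ)
    {η : ℝ} (hη : 0 < η) :
    ∃ B₁ B₂ c₁ : ℝ, 0 < B₁ ∧ 0 < B₂ ∧ 0 < c₁ ∧ Thm2TorusAt L k P η β₀ B₁ B₂ c₁ len G (Reg k P η) := by
  obtain ⟨B₁, B₂, c₁, hB₁, hB₂, hc₁, H⟩ := h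
  exact ⟨B₁, B₂, c₁, hB₁, hB₂, hc₁, H k P η hk hη⟩

/-- The existence half of the interface, unpacked: under the hypotheses a `P`-periodic `G`-valued `u` with (1.29) and an exponent field
`A` with `U′^{u⁻¹} = e^{iηA}` and the (1.36)₁ sup bound `|A| < B₁(α₀ + α₁)(Lʲη)⁻¹` at every `j ≤ k` (the member the consumers read first).
[cite: Balaban1985RegularSpaces, Thm 2 p.83, (1.36) p.82] -/
theorem Thm2TorusAt.exists_sup {L k : ℕ} {P : ℤ} {η β₀ B₁ B₂ c₁ : ℝ} {len : LSite d → ℝ} {G : Subgroup 𝔸ˣ}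
    {Reg : (LSite d → Fin d → 𝔸ˣ) → Prop} (h : Thm2TorusAt L k P η β₀ B₁ B₂ c₁ len G Reg) {α₀ α₁ : ℝ} (hα₀ : 0 < α₀)
    (hα₁ : 0 < α₁) (hc : α₀ + α₁ ≤ c₁) {U₀ U' : LSite d → Fin d → 𝔸ˣ} (hU₀ : ∀ x κ, U₀ x κ ∈ G) (hU' : ∀ x κ, U' x κ ∈ G)
    (hU₀P : ∀ i : Fin d, shiftCfg (P • e i) U₀ = U₀) (hU'P : ∀ i : Fin d, shiftCfg (P • e i) U' = U')
    (h33 : InAk L k η α₀ (fun _ => Set.univ) U₀) (hReg : Reg U₀) (h34 : InAk L k η α₀ (fun _ => Set.univ) (U' * U₀))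
    (h34' : InAx L k (torusLam k) U₀ (U' * U₀)) (h35 : Hyp135 L k (torusLam k) α₁ U₀ U') :
    ∃ (u : LSite d → 𝔸ˣ) (A : LSite d → Fin d → 𝔸), (∀ x, u x ∈ G) ∧ (∀ (x : LSite d) (i : Fin d), u (x + P • e i) = u x) ∧
      Restr129 L k (torusLam k) U₀ u ∧ (∀ (x : LSite d) (μ : Fin d), IsSelfAdjoint (A x μ)) ∧ mgauge U₀ u⁻¹ U' = cfgExp η A ∧
      ∀ j, j ≤ k → ∀ (x : LSite d) (μ : Fin d), ‖A x μ‖ < B₁ * (α₀ + α₁) * ((L : ℝ) ^ j * η)⁻¹ := by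
  obtain ⟨u, ⟨huG, huP, h129, A, hAsa, -, hexp, ⟨h36, -, -⟩, -, -, -⟩, -⟩ :=
    h hα₀ hα₁ hc U₀ U' hU₀ hU' hU₀P hU'P h33 hReg h34 h34' h35
  exact ⟨u, A, huG, huP, h129, hAsa, hexp, h36⟩

end Members

/-! ## §4 Non-vacuity of the hypothesis class -/

section NonVacuity

variable {𝔸 : Type*} [NormedRing 𝔸] [NormedAlgebra ℂ 𝔸] [CompleteSpace 𝔸]

/-- (1.35) of record for the trivial perturbation over ANY background and constraint sequence: the two averages coincide.
[cite: Balaban1985RegularSpaces, (1.35) p.82, (1.16) p.78] -/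
theorem hyp135_one_left (L k : ℕ) (Λ : ℕ → Set (LSite d)) (U₀ : LSite d → Fin d → 𝔸ˣ) {α₁ : ℝ} (hα₁ : 0 < α₁) :
    Hyp135 L k Λ α₁ U₀ (1 : LSite d → Fin d → 𝔸ˣ) := by
  intro j _ y κ _
  rw [one_mul, sub_self, norm_zero]
  exact hα₁

/-- **For ANY background the perturbation `U′ = 1` satisfies (1.34)–(1.35)**: `1·U₀ = U₀ ∈ 𝔄_k` iff `U₀` is, `U₀ ∈ Ax_k(ℭ, U₀)` for every `ℭ`
(`B8Eq119TwistedAxial.inAx_self`: all the perturbed averages (1.20) are `1`), and (1.35) holds with difference `0`.  So the hypothesis class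
of `Thm2TorusAt` over a given `U₀ ∈ 𝔄_k({T_η}, α₀)` with `Reg U₀` is not empty (p. 78 «the surfaces pass through the element U₀»).
[cite: Balaban1985RegularSpaces, (1.34)–(1.35) p.82, (1.16) p.78, (1.19)–(1.20) p.79] -/
theorem hypotheses_of_one_right (L k : ℕ) {η α₀ α₁ : ℝ} (hα₁ : 0 < α₁) (Λ Ω : ℕ → Set (LSite d))
    {U₀ : LSite d → Fin d → 𝔸ˣ} (h33 : InAk L k η α₀ Ω U₀) :
    InAk L k η α₀ Ω ((1 : LSite d → Fin d → 𝔸ˣ) * U₀) ∧ InAx L k Λ U₀ ((1 : LSite d → Fin d → 𝔸ˣ) * U₀) ∧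
      Hyp135 L k Λ α₁ U₀ (1 : LSite d → Fin d → 𝔸ˣ) := by
  refine ⟨by rw [one_mul]; exact h33, by rw [one_mul]; exact inAx_self L k Λ U₀, hyp135_one_left L k Λ U₀ hα₁⟩

/-- **The trivial pair `U₀ = 1`, `U′ = 1` satisfies (1.33)₁, (1.34), (1.35)** for every `α₀, α₁ > 0`, `η > 0`, `L ≥ 1`, on every domain ∕
constraint sequence (`B8Prop6OfThm4.one_inAk`: `1 ∈ 𝔄_k`; p. 98 «The configuration identically equal to 1 satisfies, of course, all possible
regularity conditions»; with the concrete (3.35) this is r05's `B8Eq133Hypotheses.hyp133to135_one`). [cite: Balaban1985RegularSpaces, (1.33)–(1.35) p.82, p.98] -/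
theorem hypotheses_one_one {L : ℕ} (hL : 1 ≤ L) (k : ℕ) {η α₀ α₁ : ℝ} (hη : 0 < η) (hα₀ : 0 < α₀) (hα₁ : 0 < α₁)
    (Λ Ω : ℕ → Set (LSite d)) :
    InAk L k η α₀ Ω (1 : LSite d → Fin d → 𝔸ˣ) ∧ InAk L k η α₀ Ω ((1 : LSite d → Fin d → 𝔸ˣ) * 1) ∧
      InAx L k Λ (1 : LSite d → Fin d → 𝔸ˣ) ((1 : LSite d → Fin d → 𝔸ˣ) * 1) ∧
      Hyp135 L k Λ α₁ (1 : LSite d → Fin d → 𝔸ˣ) (1 : LSite d → Fin d → 𝔸ˣ) := by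
  have h1 : InAk L k η α₀ Ω (1 : LSite d → Fin d → 𝔸ˣ) := B8Prop6OfThm4.one_inAk hL k hη hα₀ Ω
  exact ⟨h1, hypotheses_of_one_right L k hα₁ Λ Ω h1⟩

end NonVacuity

/-! ## §5 Theorem 2 (torus geometry) APPLIES at a pair with equal `k`-th averages -/

section Pair

variable {𝔸 : Type*} [NormedRing 𝔸] [StarRing 𝔸] [NormOneClass 𝔸] [NormedAlgebra ℂ 𝔸] [CompleteSpace 𝔸]

omit [StarRing 𝔸] in
/-- **(1.35) AT THE PAIR, EXACTLY**: for `G`-valued `U₀`, `U` (`G` `AvgClosed`, `L ≥ 2`) with (1.7) `sup_p |·(∂p) − 1| < α·L^{−2k}` (`α`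
Prop.-1∕2-small) and EQUAL `k`-th averages `Ūᵏ = Ū₀ᵏ`, the perturbation `U′ = U^{u₀}U₀⁻¹` of the axial representative (`u₀ = ptw L U₀ U k`)
satisfies `Cond135T L k U₀ U′ α₁` for EVERY `α₁ > 0`: `(U′U₀)‾ᵏ = (U^{u₀})‾ᵏ = Ūᵏ` («the top average is kept»,
`B8Eq166ConstraintPair.pinnedTwistedFix_global`) `= Ū₀ᵏ`. [cite: Balaban1985RegularSpaces, (1.35) p.82, (1.19) p.79, (1.13)–(1.14) p.78] -/
theorem cond135T_pertPair (L : ℕ) (hL : 2 ≤ L) {G : Subgroup 𝔸ˣ} (hG : AvgClosed d L G) (k : ℕ)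
    (U₀ U : LSite d → Fin d → 𝔸ˣ) (hU₀ : ∀ x κ, U₀ x κ ∈ G) (hU : ∀ x κ, U x κ ∈ G) {α : ℝ} (hα : 0 < α)
    (hα3 : C0 d * α ≤ 1 / 3) (hα2 : 2 * α ≤ c2' d L)
    (h33 : pdev U₀ < α * (((L : ℝ) ^ k)⁻¹) ^ 2) (h34 : pdev U < α * (((L : ℝ) ^ k)⁻¹) ^ 2)
    (hpair : avgIter L U k = avgIter L U₀ k) {α₁ : ℝ} (hα₁ : 0 < α₁) :
    Cond135T L k U₀ (pert (gaugeAct (ptw L U₀ U k) U) U₀) α₁ := by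
  obtain ⟨-, -, -, -, -, hkeep⟩ := pinnedTwistedFix_global L hL hG k U₀ U hU₀ hU hα hα3 hα2 h33 h34
  exact cond135T_of_avgIter_eq (by rw [pertPair_mul, hkeep, hpair]) hα₁

/-- **THEOREM 2 (TORUS GEOMETRY) APPLIES AT THE PAIR** (modus ponens; the Theorem-2 twin of `B8Thm4TorusAt.concl_of_thm4TorusAt_pair`, the
consumer's «gauge chart» shape): for an `AvgClosed` gauge group `G`, `L ≥ 2`, `G`-valued `N·Lᵏ`-periodic `U₀`, `U` with (1.7)
`sup_p |·(∂p) − 1| < α·L^{−2k}` (`α` Prop.-1∕2-small) and EQUAL `k`-th averages `Ūᵏ = Ū₀ᵏ`, if Theorem 2 holds in the form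
`Thm2TorusAt L k (N·Lᵏ) η β₀ B₁ B₂ c₁ len G Reg` and `α + α₁ ≤ c₁` for some `α₁ > 0`, then from `U₀ ∈ 𝔄_k({T_η}, α)`, `Reg U₀` and
`U ∈ 𝔄_k({T_η}, α)` ALONE there is exactly one periodic `G`-valued `u` with (1.29) on `Λ_k = T^{(k)}` and (1.36)–(1.39) (`Concl2T … α α₁`)
for `U₁ = U′^{u⁻¹}`, `U′ = U^{u₀}U₀⁻¹`, `u₀ = ptw L U₀ U k` — the clauses (1.34) (axial, `inAx_pertPair`) and (1.35) (`cond135T_pertPair`)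
being theorems at the pair. [cite: Balaban1985RegularSpaces, Thm 2 p.83, (1.33)–(1.35) p.82, (1.19) p.79, p.77] -/
theorem concl_of_thm2TorusAt_pair (L : ℕ) (hL : 2 ≤ L) {G : Subgroup 𝔸ˣ} (hG : AvgClosed d L G) (N k : ℕ)
    {η β₀ B₁ B₂ c₁ : ℝ} {len : LSite d → ℝ} {Reg : (LSite d → Fin d → 𝔸ˣ) → Prop}
    (hThm2 : Thm2TorusAt L k (((N * L ^ k : ℕ) : ℤ)) η β₀ B₁ B₂ c₁ len G Reg)
    (U₀ U : LSite d → Fin d → 𝔸ˣ) (hU₀ : ∀ x κ, U₀ x κ ∈ G) (hU : ∀ x κ, U x κ ∈ G)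
    (hU₀P : ∀ i : Fin d, shiftCfg (((N * L ^ k : ℕ) : ℤ) • e i) U₀ = U₀)
    (hUP : ∀ i : Fin d, shiftCfg (((N * L ^ k : ℕ) : ℤ) • e i) U = U) {α α₁ : ℝ} (hα : 0 < α) (hα₁ : 0 < α₁)
    (hα3 : C0 d * α ≤ 1 / 3) (hα2 : 2 * α ≤ c2' d L)
    (h33 : pdev U₀ < α * (((L : ℝ) ^ k)⁻¹) ^ 2) (h34 : pdev U < α * (((L : ℝ) ^ k)⁻¹) ^ 2)
    (hpair : avgIter L U k = avgIter L U₀ k) (hc₁ : α + α₁ ≤ c₁)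
    (hA₀ : InAk L k η α (fun _ => Set.univ) U₀) (hReg : Reg U₀) (hA : InAk L k η α (fun _ => Set.univ) U) :
    ∃ u : LSite d → 𝔸ˣ,
      ((∀ x, u x ∈ G) ∧ (∀ (x : LSite d) (i : Fin d), u (x + (((N * L ^ k : ℕ) : ℤ)) • e i) = u x) ∧
          Restr129 L k (torusLam k) U₀ u ∧
          Concl2T L k (((N * L ^ k : ℕ) : ℤ)) η β₀ B₁ B₂ len α α₁ U₀ (pert (gaugeAct (ptw L U₀ U k) U) U₀) u) ∧
      ∀ u' : LSite d → 𝔸ˣ, (∀ x, u' x ∈ G) → (∀ (x : LSite d) (i : Fin d), u' (x + (((N * L ^ k : ℕ) : ℤ)) • e i) = u' x) →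
        Restr129 L k (torusLam k) U₀ u' →
          Concl2T L k (((N * L ^ k : ℕ) : ℤ)) η β₀ B₁ B₂ len α α₁ U₀ (pert (gaugeAct (ptw L U₀ U k) U) U₀) u' → u' = u := by
  have hL1 : 1 ≤ L := le_trans (by norm_num) hL
  obtain ⟨huG, hUuG, -, -, -, -⟩ := pinnedTwistedFix_global L hL hG k U₀ U hU₀ hU hα hα3 hα2 h33 h34
  have huU : ∀ x, ptw L U₀ U k x ∈ U1 𝔸 := fun x => hG.le_U1 (huG x)
  exact hThm2 hα hα₁ hc₁ U₀ (pert (gaugeAct (ptw L U₀ U k) U) U₀) hU₀ (pertPair_mem hU₀ hUuG) hU₀P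
    (pertPair_periodic hL1 N k hU₀P hUP) hA₀ hReg
    ((inAk_pertPair_iff L k η α _ huU).2 hA)
    (inAx_pertPair L hL hG k U₀ U hU₀ hU hα hα3 hα2 h33 h34 _)
    ((hyp135_torusLam_iff L k U₀ _ α₁).2 (cond135T_pertPair L hL hG k U₀ U hU₀ hU hα hα3 hα2 h33 h34 hpair hα₁))

end Pair

end Literature.MathematicalPhysics.QuantumFieldTheory.Balaban1983to89.B8Thm2TorusAt

end
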